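import Literature.Combinatorics.StablePolynomials.ExteriorDiskSupport
import HarnessLib

/-!
# The inversion `I_κ : z^α ↦ z^{κ-α}` between `𝔻`-stable and `(ℂ ∖ 𝔻̄)`-stable polynomials
# (Borcea–Brändén II, Corollary 1.7)

J. Borcea, P. Brändén, *The Lee–Yang and Pólya–Schur programs. II. Theory of stable polynomials and
applications*, Comm. Pure Appl. Math. 62 (2009) 1595–1631 (arXiv:0809.3087), §1:

> An immediate consequence of Lemma 1.6 is the following.
>
> **Corollary 1.7.** Let `κ ∈ ℕⁿ` and `I_κ : ℂ_κ[z_1,…,z_n] → ℂ_κ[z_1,…,z_n]` be the linear operator defined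
> by `I_κ(z^α) = z^{κ-α}`, `α ≤ κ`. Then `I_κ` restricts to a bijection between the set of `𝔻`-stable
> (`𝔻̄`-stable) polynomials in `ℂ_κ[z_1,…,z_n]` and the set of `ℂ ∖ 𝔻̄`-stable (`ℂ ∖ 𝔻`-stable) polynomials
> in `ℂ_κ[z_1,…,z_n]` of degree `κ`.

Here Lemma 1.6 is part I's Lemma 6.1 (the tree's `ExteriorDiskSupport.lean`). This file proves the
statement for the open unit disc `𝔻` and the exterior `ℂ ∖ 𝔻̄` of the closed unit disc:

* `invOp κ p = Σ_α a(α) z^{κ-α}` (`I_κ`), an involution of `ℂ_κ[z]` (`invOp_invOp`) with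
  `I_κ(p)(z) = z^κ p(1/z)` off the coordinate hyperplanes (`eval_invOp`);
* `𝔻`-stable `⟹` `I_κ(p)` is `(ℂ ∖ 𝔻̄)`-stable of degree `κ` (`invOp_exteriorDiskStable`,
  `degVec_invOp_eq`) — elementary;
* `(ℂ ∖ 𝔻̄)`-stable of degree `κ` `⟹` `I_κ(q)` is `𝔻`-stable (`invOp_diskStable`) — this is where
  Lemma 1.6/6.1 enters: at a point `z ∈ 𝔻ⁿ` with zero coordinates `Z`,
  `I_κ(q)(z) = (Π_{i∉Z} z_i^{κ_i}) · c_Z(q)(1/z)` where `c_Z(q)` is the coefficient of `Π_{i∈Z} z_i^{κ_i}` in `q`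
  (`cornerPoly q Z`, `eval_invOp_eq_cornerPoly`), and `c_Z(q)` has no zeros with `|u_j| > 1` (`j ∉ Z`) by
  induction on `Z`, each step being the leading-coefficient half of Lemma 6.1
  (`eval_leadingSliceCoeff_ne_zero`) applied to a polynomial whose degree in the new variable is still
  `κ_i` because the corner coefficient `a(κ)` of `q` is non-zero (Lemma 6.1, `J = [n]`).

-- TODO(general form): the closed-disc version (`𝔻̄`-stable ↔ `ℂ ∖ 𝔻`-stable of degree `κ`), loc. cit.

## Main results (namespace `Literature.Combinatorics.StablePolynomials`)

* `invOp`, `coeff_invOp`, `invOp_fits`, `invOp_invOp`, `eval_invOp`.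
* `cornerPoly`, `coeff_cornerPoly`, `coeff_sliceCoeff`, `sliceCoeff_cornerPoly`, `eval_cornerPoly_ne_zero`,
  `eval_invOp_eq_cornerPoly`.
* **`invOp_exteriorDiskStable`**, **`degVec_invOp_eq`**, **`invOp_diskStable`**,
  **`BorceaBranden_diskInversion`** — Corollary 1.7 (open disc / exterior of the closed disc).

## References

* [BorceaBranden2009II] J. Borcea, P. Brändén, Comm. Pure Appl. Math. 62 (2009) 1595–1631, §1 Cor. 1.7
  (and Lemma 1.6).
* [BorceaBranden2009] J. Borcea, P. Brändén, Invent. Math. 177 (2009) 541–569, §6.1 Lemma 6.1.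
-/

noncomputable section

open MvPolynomial Finset

namespace Literature.Combinatorics.StablePolynomials

variable {σ : Type*} [Fintype σ] [DecidableEq σ]

/-! ## §1 The inversion `I_κ` -/

section Inversion

/-- **`I_κ(z^α) = z^{κ-α}`**, extended linearly: `I_κ(p) = Σ_α a(α) z^{κ-α}` (meant for `p ∈ ℂ_κ[z]`, i.e.
`α ≤ κ` on the support). [cite: BorceaBranden2009II, §1 Cor. 1.7 (definition of `I_κ`)] -/
def invOp (κ : σ →₀ ℕ) (p : MvPolynomial σ ℂ) : MvPolynomial σ ℂ :=
  ∑ α ∈ p.support, monomial (κ - α) (coeff α p)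

omit [Fintype σ] in
/-- Coefficients of `I_κ(p)` for `p ∈ ℂ_κ[z]`: `[z^{κ-β}] I_κ(p) = a(β)` (`β ≤ κ`).
[cite: BorceaBranden2009II, §1 Cor. 1.7] -/
theorem coeff_invOp {κ : σ →₀ ℕ} {p : MvPolynomial σ ℂ} (hp : ∀ α ∈ p.support, α ≤ κ) {β : σ →₀ ℕ}
    (hβ : β ≤ κ) : coeff (κ - β) (invOp κ p) = coeff β p := by
  rw [invOp, coeff_sum]
  by_cases hβs : β ∈ p.support
  · rw [Finset.sum_eq_single_of_mem β hβs fun α hα hne => by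
      rw [coeff_monomial]
      exact if_neg fun h => hne (by rw [← tsub_tsub_cancel_of_le (hp α hα), h, tsub_tsub_cancel_of_le hβ]),
      coeff_monomial, if_pos rfl]
  · rw [notMem_support_iff.1 hβs]
    exact Finset.sum_eq_zero fun α hα => by
      rw [coeff_monomial]
      exact if_neg fun h => hβs (by
        rw [← tsub_tsub_cancel_of_le hβ, ← h, tsub_tsub_cancel_of_le (hp α hα)]; exact hα)

omit [Fintype σ] in
/-- Every exponent of `I_κ(p)` is `κ - α` for some `α ∈ supp(p)`; in particular `I_κ(p) ∈ ℂ_κ[z]`.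
[cite: BorceaBranden2009II, §1 Cor. 1.7 (`I_κ : ℂ_κ[z] → ℂ_κ[z]`)] -/
theorem exists_of_mem_support_invOp {κ : σ →₀ ℕ} {p : MvPolynomial σ ℂ} {γ : σ →₀ ℕ}
    (hγ : γ ∈ (invOp κ p).support) : ∃ α ∈ p.support, γ = κ - α := by
  rw [mem_support_iff, invOp, coeff_sum] at hγ
  obtain ⟨α, hα, hne⟩ := Finset.exists_ne_zero_of_sum_ne_zero hγ
  rw [coeff_monomial] at hne
  by_cases h : κ - α = γ
  · exact ⟨α, hα, h.symm⟩
  · exact absurd (if_neg h) hne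

omit [Fintype σ] in
/-- `I_κ(p) ∈ ℂ_κ[z]`. [cite: BorceaBranden2009II, §1 Cor. 1.7] -/
theorem invOp_fits (κ : σ →₀ ℕ) (p : MvPolynomial σ ℂ) : ∀ γ ∈ (invOp κ p).support, γ ≤ κ := by
  intro γ hγ
  obtain ⟨α, -, rfl⟩ := exists_of_mem_support_invOp hγ
  exact tsub_le_self

omit [Fintype σ] in
/-- **`I_κ` is an involution of `ℂ_κ[z]`.** [cite: BorceaBranden2009II, §1 Cor. 1.7 ("restricts to a
bijection")] -/
theorem invOp_invOp {κ : σ →₀ ℕ} {p : MvPolynomial σ ℂ} (hp : ∀ α ∈ p.support, α ≤ κ) :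
    invOp κ (invOp κ p) = p := by
  ext β
  by_cases hβ : β ≤ κ
  · rw [← tsub_tsub_cancel_of_le hβ, coeff_invOp (invOp_fits κ p) tsub_le_self,
      coeff_invOp hp hβ, tsub_tsub_cancel_of_le hβ]
  · rw [notMem_support_iff.1 fun h => hβ (invOp_fits κ _ β h),
      notMem_support_iff.1 fun h => hβ (hp β h)]

omit [DecidableEq σ] in
/-- **`I_κ(p)(z) = z^κ p(1/z)`** off the coordinate hyperplanes (`p ∈ ℂ_κ[z]`).
[cite: BorceaBranden2009II, §1 Cor. 1.7] -/
theorem eval_invOp {κ : σ →₀ ℕ} {p : MvPolynomial σ ℂ} (hp : ∀ α ∈ p.support, α ≤ κ) {z : σ → ℂ}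
    (hz : ∀ i, z i ≠ 0) : eval z (invOp κ p) = (∏ i, z i ^ κ i) * eval (fun i => (z i)⁻¹) p := by
  rw [invOp, map_sum, eval_eq', Finset.mul_sum]
  refine Finset.sum_congr rfl fun α hα => ?_
  rw [eval_monomial, Finsupp.prod_fintype _ _ fun i => pow_zero _, mul_left_comm]
  congr 1
  rw [← Finset.prod_mul_distrib]
  refine Finset.prod_congr rfl fun i _ => ?_
  rw [Finsupp.tsub_apply, pow_sub₀ _ (hz i) (hp α hα i), inv_pow]

end Inversion

/-! ## §2 Corner coefficients `c_Z(q)` -/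

section Corner

/-- **The corner coefficient `c_Z(q)`**: the coefficient of `Π_{i∈Z} z_i^{κ_i}` (`κ_i = deg_{z_i} q`) in `q`,
a polynomial in the variables `z_j`, `j ∉ Z`: `c_Z(q) = Σ_{α : α_i = κ_i (i ∈ Z)} a(α) Π_{j∉Z} z_j^{α_j}`.
[cite: BorceaBranden2009II, §1 Lemma 1.6 (the specialisations `g` and their maximal element `γ`)] -/
def cornerPoly (q : MvPolynomial σ ℂ) (Z : Finset σ) : MvPolynomial σ ℂ :=
  ∑ α ∈ q.support with (∀ i ∈ Z, α i = q.degreeOf i),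
    monomial (α.filter fun i => i ∉ Z) (coeff α q)

omit [Fintype σ] in
/-- The exponent bookkeeping: `α ↦ α|_{Zᶜ}` is inverted by adding back `Σ_{i∈Z} κ_i e_i`.
[cite: BorceaBranden2009II, §1 Lemma 1.6] -/
theorem filter_add_sum_single {Z : Finset σ} {κ : σ → ℕ} {α : σ →₀ ℕ} (hα : ∀ i ∈ Z, α i = κ i) :
    α.filter (fun i => i ∉ Z) + ∑ i ∈ Z, Finsupp.single i (κ i) = α := by
  ext j
  rw [Finsupp.add_apply, Finsupp.filter_apply, Finsupp.finsetSum_apply]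
  by_cases hj : j ∈ Z
  · rw [if_neg (not_not.2 hj), zero_add, Finset.sum_eq_single_of_mem j hj fun i _ hij =>
      Finsupp.single_eq_of_ne' hij, Finsupp.single_eq_same, hα j hj]
  · rw [if_pos hj, Finset.sum_eq_zero fun i hi => Finsupp.single_eq_of_ne' fun h => hj (by rw [← h]; exact hi),
      add_zero]

/-- **Coefficients of `c_Z(q)`**: `[z^δ] c_Z(q) = a(δ + Σ_{i∈Z} κ_i e_i)` if `δ` vanishes on `Z`, else `0`.
[cite: BorceaBranden2009II, §1 Lemma 1.6] -/
theorem coeff_cornerPoly (q : MvPolynomial σ ℂ) (Z : Finset σ) (δ : σ →₀ ℕ) :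
    coeff δ (cornerPoly q Z) =
      if ∀ i ∈ Z, δ i = 0 then coeff (δ + ∑ i ∈ Z, Finsupp.single i (q.degreeOf i)) q else 0 := by
  rw [cornerPoly, coeff_sum]
  split_ifs with hδ
  · set α₀ := δ + ∑ i ∈ Z, Finsupp.single i (q.degreeOf i) with hα₀
    have hα₀Z : ∀ i ∈ Z, α₀ i = q.degreeOf i := fun i hi => by
      rw [hα₀, Finsupp.add_apply, hδ i hi, zero_add, Finsupp.finsetSum_apply,
        Finset.sum_eq_single_of_mem i hi fun j _ hji => Finsupp.single_eq_of_ne' hji, Finsupp.single_eq_same]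
    have hfilt : α₀.filter (fun i => i ∉ Z) = δ := by
      have h := filter_add_sum_single hα₀Z
      rw [hα₀] at h ⊢
      exact add_right_cancel h
    by_cases hmem : α₀ ∈ q.support
    · rw [Finset.sum_eq_single_of_mem α₀ (Finset.mem_filter.2 ⟨hmem, hα₀Z⟩) fun α hα hne => by
        rw [coeff_monomial]
        refine if_neg fun h => hne ?_
        rw [← filter_add_sum_single (Finset.mem_filter.1 hα).2, h, ← hfilt, filter_add_sum_single hα₀Z],
        coeff_monomial, if_pos hfilt]
    · rw [notMem_support_iff.1 hmem]
      exact Finset.sum_eq_zero fun α hα => by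
        rw [coeff_monomial]
        refine if_neg fun h => hmem ?_
        rw [hα₀, ← h, filter_add_sum_single (Finset.mem_filter.1 hα).2]
        exact (Finset.mem_filter.1 hα).1
  · push Not at hδ
    obtain ⟨i, hi, hδi⟩ := hδ
    exact Finset.sum_eq_zero fun α _ => by
      rw [coeff_monomial]
      exact if_neg fun h => hδi (by rw [← h, Finsupp.filter_apply, if_neg (not_not.2 hi)])

/-- `c_∅(q) = q`. [cite: BorceaBranden2009II, §1 Lemma 1.6 (`J = [n]`: no variable specialised)] -/
theorem cornerPoly_empty (q : MvPolynomial σ ℂ) : cornerPoly q ∅ = q := by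
  ext δ
  rw [coeff_cornerPoly, if_pos fun i hi => absurd hi (Finset.notMem_empty i), Finset.sum_empty, add_zero]

omit [Fintype σ] in
/-- **Coefficients of a slice**: `[z^γ] (sliceCoeff h i k) = [z^{γ + k e_i}] h` if `γ_i = 0`, else `0`.
[cite: BorceaBranden2009, §6.1 Lemma 6.1 (leading coefficients in one variable)] -/
theorem coeff_sliceCoeff (h : MvPolynomial σ ℂ) (i : σ) (k : ℕ) (γ : σ →₀ ℕ) :
    coeff γ (sliceCoeff h i k) = if γ i = 0 then coeff (γ + Finsupp.single i k) h else 0 := by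
  rw [sliceCoeff, coeff_sum]
  split_ifs with hγ
  · set α₀ := γ + Finsupp.single i k with hα₀
    have herase : α₀.erase i = γ := by
      ext j
      by_cases hji : j = i
      · subst hji; rw [Finsupp.erase_same, hγ]
      · rw [Finsupp.erase_ne hji, hα₀, Finsupp.add_apply, Finsupp.single_eq_of_ne hji, add_zero]
    have hi : α₀ i = k := by
      rw [hα₀, Finsupp.add_apply, hγ, zero_add, Finsupp.single_eq_same]
    have key : ∀ α ∈ h.support.filter (fun α => α i = k), α.erase i = γ → α = α₀ := fun α hα heq => by
      rw [← Finsupp.erase_add_single i α, heq, (Finset.mem_filter.1 hα).2]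
    by_cases hmem : α₀ ∈ h.support
    · rw [Finset.sum_eq_single_of_mem α₀ (Finset.mem_filter.2 ⟨hmem, hi⟩) fun α hα hne => by
        rw [coeff_monomial]
        exact if_neg fun heq => hne (key α hα heq), coeff_monomial, if_pos herase]
    · rw [notMem_support_iff.1 hmem]
      exact Finset.sum_eq_zero fun α hα => by
        rw [coeff_monomial]
        exact if_neg fun heq => hmem (by rw [← key α hα heq]; exact (Finset.mem_filter.1 hα).1)
  · exact Finset.sum_eq_zero fun α _ => by
      rw [coeff_monomial]
      exact if_neg fun heq => hγ (by rw [← heq, Finsupp.erase_same])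

/-- **Slicing a corner coefficient**: for `i ∉ Z`, the coefficient of `z_i^{κ_i}` in `c_Z(q)` is
`c_{Z ∪ {i}}(q)`. [cite: BorceaBranden2009II, §1 Lemma 1.6] -/
theorem sliceCoeff_cornerPoly (q : MvPolynomial σ ℂ) {Z : Finset σ} {i : σ} (hi : i ∉ Z) :
    sliceCoeff (cornerPoly q Z) i (q.degreeOf i) = cornerPoly q (insert i Z) := by
  ext γ
  rw [coeff_sliceCoeff, coeff_cornerPoly, coeff_cornerPoly]
  by_cases hγi : γ i = 0
  · rw [if_pos hγi]
    have hZ : (∀ j ∈ Z, (γ + Finsupp.single i (q.degreeOf i)) j = 0) ↔ ∀ j ∈ insert i Z, γ j = 0 := by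
      rw [Finset.forall_mem_insert]
      refine ⟨fun h => ⟨hγi, fun j hj => ?_⟩, fun h j hj => ?_⟩
      · have := h j hj
        rwa [Finsupp.add_apply, Finsupp.single_eq_of_ne (fun hji : j = i => hi (by rw [← hji]; exact hj)),
          add_zero] at this
      · rw [Finsupp.add_apply, h.2 j hj,
          Finsupp.single_eq_of_ne (fun hji : j = i => hi (by rw [← hji]; exact hj)), add_zero]
    by_cases hall : ∀ j ∈ insert i Z, γ j = 0
    · rw [if_pos (hZ.2 hall), if_pos hall, Finset.sum_insert hi, ← add_assoc]
    · rw [if_neg (fun h => hall (hZ.1 h)), if_neg hall]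
  · rw [if_neg hγi, if_neg fun h => hγi (h i (Finset.mem_insert_self i Z))]

/-- The degree of `c_Z(q)` in a free variable `i ∉ Z` is still `κ_i` when the corner coefficient `a(κ)`
of `q` is non-zero. [cite: BorceaBranden2009II, §1 Lemma 1.6 ("`γ` is the same for all choices")] -/
theorem degreeOf_cornerPoly {q : MvPolynomial σ ℂ} (hq : degVec q ∈ q.support) {Z : Finset σ} {i : σ}
    (hi : i ∉ Z) : (cornerPoly q Z).degreeOf i = q.degreeOf i := by
  refine le_antisymm (degreeOf_le_iff.2 fun δ hδ => ?_) ?_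
  · have h := mem_support_iff.1 hδ
    rw [coeff_cornerPoly] at h
    split_ifs at h with hZ
    · have hmem := mem_support_iff.2 h
      have := monomial_le_degreeOf i hmem
      rwa [Finsupp.add_apply, Finsupp.finsetSum_apply,
        Finset.sum_eq_zero (fun j hj => Finsupp.single_eq_of_ne fun hij : i = j => hi (by rw [hij]; exact hj)),
        add_zero] at this
    · exact absurd rfl h
  · set δ := (degVec q).filter (fun j => j ∉ Z) with hδ
    have hcoeff : coeff δ (cornerPoly q Z) ≠ 0 := by
      rw [coeff_cornerPoly, if_pos fun j hj => by rw [hδ, Finsupp.filter_apply, if_neg (not_not.2 hj)]]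
      have hκ : ∀ j ∈ Z, degVec q j = q.degreeOf j := fun j _ => degVec_apply q j
      rw [hδ, filter_add_sum_single hκ]
      exact mem_support_iff.1 hq
    have := monomial_le_degreeOf i (mem_support_iff.2 hcoeff)
    rwa [hδ, Finsupp.filter_apply, if_pos hi, degVec_apply] at this

/-- **The corner coefficients of a `(ℂ ∖ 𝔻̄)ⁿ`-stable polynomial are zero-free**: `c_Z(q)(u) ≠ 0` whenever
`|u_j| > 1` for all `j ∉ Z` (induction on `Z` by the leading-coefficient half of Lemma 6.1, the degrees being
kept equal to `κ_i` by the corner coefficient `a(κ) ≠ 0`). [cite: BorceaBranden2009II, §1 Lemma 1.6;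
BorceaBranden2009, §6.1 Lemma 6.1] -/
theorem eval_cornerPoly_ne_zero {q : MvPolynomial σ ℂ}
    (hq : ∀ z : σ → ℂ, (∀ i, 1 < ‖z i‖) → eval z q ≠ 0) (Z : Finset σ) {u : σ → ℂ}
    (hu : ∀ j, j ∉ Z → 1 < ‖u j‖) : eval u (cornerPoly q Z) ≠ 0 := by
  have hκ : degVec q ∈ q.support := degVec_mem_support_of_exteriorDiskStable hq
  induction Z using Finset.induction_on generalizing u with
  | empty =>
    rw [cornerPoly_empty]
    exact hq u fun j => hu j (Finset.notMem_empty j)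
  | insert i Z hi ih =>
    rw [← sliceCoeff_cornerPoly q hi, ← degreeOf_cornerPoly hκ hi]
    have hopen : IsOpen {z : σ → ℂ | ∀ j, j ∉ insert i Z → 1 < ‖z j‖} := by
      simp only [Set.setOf_forall]
      exact isOpen_iInter_of_finite fun j => isOpen_iInter_of_finite fun _ =>
        isOpen_lt continuous_const (continuous_apply j).norm
    refine eval_leadingSliceCoeff_ne_zero hopen (fun z hz v hv => ih fun j hj => ?_) hu
    by_cases hji : j = i
    · subst hji
      rwa [Function.update_self]
    · rw [Function.update_of_ne hji]
      exact hz j fun h => (Finset.mem_insert.1 h).elim hji hj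

/-- **`I_κ(q)` at a point with zero coordinates `Z`**: `I_κ(q)(z) = (Π_{j∉Z} z_j^{κ_j}) · c_Z(q)(1/z)` for
`q ∈ ℂ_κ[z]` of degree `κ` (`κ_i = deg_{z_i} q`). [cite: BorceaBranden2009II, §1 Cor. 1.7 (via Lemma 1.6)] -/
theorem eval_invOp_eq_cornerPoly {q : MvPolynomial σ ℂ} (hq : ∀ α ∈ q.support, α ≤ degVec q) (z : σ → ℂ) :
    eval z (invOp (degVec q) q) =
      (∏ j ∈ Finset.univ.filter (fun j => z j ≠ 0), z j ^ degVec q j) *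
        eval (fun j => (z j)⁻¹) (cornerPoly q (Finset.univ.filter fun j => z j = 0)) := by
  set Z := Finset.univ.filter (fun j => z j = 0) with hZ
  have hZc : Finset.univ.filter (fun j => z j ≠ 0) = Finset.univ.filter (fun j => j ∉ Z) := by
    ext j; simp [hZ]
  rw [hZc, invOp, map_sum, cornerPoly, map_sum, Finset.mul_sum, Finset.sum_filter]
  refine Finset.sum_congr rfl fun α hα => ?_
  have hακ : α ≤ degVec q := hq α hα
  rw [eval_monomial, eval_monomial, Finsupp.prod_fintype _ _ fun j => pow_zero _,
    Finsupp.prod_fintype _ _ fun j => pow_zero _,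
    ← Finset.prod_filter_mul_prod_filter_not Finset.univ (fun j => j ∉ Z)]
  -- the factors over `Z`: `0^{κ_j - α_j}`
  have hprodZ : (∏ j ∈ Finset.univ.filter (fun j => ¬ j ∉ Z), z j ^ (degVec q - α) j) =
      if ∀ j ∈ Z, α j = q.degreeOf j then 1 else 0 := by
    split_ifs with h
    · refine Finset.prod_eq_one fun j hj => ?_
      have hjZ : j ∈ Z := not_not.1 (Finset.mem_filter.1 hj).2
      rw [Finsupp.tsub_apply, degVec_apply, ← h j hjZ, Nat.sub_self, pow_zero]
    · push Not at h
      obtain ⟨j, hjZ, hne⟩ := h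
      refine Finset.prod_eq_zero (Finset.mem_filter.2 ⟨Finset.mem_univ j, not_not.2 hjZ⟩) ?_
      have hz0 : z j = 0 := (Finset.mem_filter.1 hjZ).2
      rw [hz0, zero_pow]
      rw [Finsupp.tsub_apply]
      have := hακ j
      rw [degVec_apply] at this ⊢
      omega
  rw [hprodZ]
  split_ifs with h
  · rw [mul_one, ← mul_assoc, mul_comm (∏ j ∈ _, z j ^ degVec q j), mul_assoc]
    congr 1
    rw [← Finset.prod_filter_mul_prod_filter_not Finset.univ (fun j => j ∉ Z)
      (fun j => (z j)⁻¹ ^ (Finsupp.filter (fun i => i ∉ Z) α) j)]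
    have h1 : (∏ j ∈ Finset.univ.filter (fun j => ¬ j ∉ Z), (z j)⁻¹ ^ (Finsupp.filter (fun i => i ∉ Z) α) j)
        = 1 := Finset.prod_eq_one fun j hj => by
      rw [Finsupp.filter_apply, if_neg (Finset.mem_filter.1 hj).2, pow_zero]
    rw [h1, mul_one, ← Finset.prod_mul_distrib]
    refine Finset.prod_congr rfl fun j hj => ?_
    have hjZ : j ∉ Z := (Finset.mem_filter.1 hj).2
    have hzj : z j ≠ 0 := fun h0 => hjZ (Finset.mem_filter.2 ⟨Finset.mem_univ j, h0⟩)
    rw [Finsupp.filter_apply, if_pos hjZ, Finsupp.tsub_apply, pow_sub₀ _ hzj (hακ j), inv_pow]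
  · rw [mul_zero, mul_zero]

end Corner

/-! ## §3 Corollary 1.7 -/

section Main

omit [DecidableEq σ] in
/-- **`𝔻`-stable ⟹ `I_κ(p)` is `(ℂ ∖ 𝔻̄)`-stable** (`p ∈ ℂ_κ[z]`): for `|z_i| > 1`, `I_κ(p)(z) = z^κ p(1/z) ≠ 0`.
[cite: BorceaBranden2009II, §1 Cor. 1.7] -/
theorem invOp_exteriorDiskStable {κ : σ →₀ ℕ} {p : MvPolynomial σ ℂ} (hp : ∀ α ∈ p.support, α ≤ κ)
    (hst : ∀ z : σ → ℂ, (∀ i, ‖z i‖ < 1) → eval z p ≠ 0) (z : σ → ℂ) (hz : ∀ i, 1 < ‖z i‖) :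
    eval z (invOp κ p) ≠ 0 := by
  have hz0 : ∀ i, z i ≠ 0 := fun i h => by
    have := hz i
    rw [h, norm_zero] at this
    exact absurd this (not_lt.2 zero_le_one)
  rw [eval_invOp hp hz0]
  refine mul_ne_zero (Finset.prod_ne_zero_iff.2 fun i _ => pow_ne_zero _ (hz0 i)) (hst _ fun i => ?_)
  rw [norm_inv]
  exact inv_lt_one_of_one_lt₀ (hz i)

/-- **`I_κ(p)` has degree exactly `κ`** when `p ∈ ℂ_κ[z]` is `𝔻`-stable (`p(0) ≠ 0`, so `a(0) ≠ 0` is the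
corner coefficient of `I_κ(p)`). [cite: BorceaBranden2009II, §1 Cor. 1.7 ("of degree `κ`")] -/
theorem degVec_invOp_eq {κ : σ →₀ ℕ} {p : MvPolynomial σ ℂ} (hp : ∀ α ∈ p.support, α ≤ κ)
    (hst : ∀ z : σ → ℂ, (∀ i, ‖z i‖ < 1) → eval z p ≠ 0) : degVec (invOp κ p) = κ := by
  refine le_antisymm (Finsupp.le_def.2 fun i => ?_) ?_
  · rw [degVec_apply]
    exact degreeOf_le_iff.2 fun γ hγ => invOp_fits κ p γ hγ i
  · have h0 : coeff 0 p ≠ 0 := by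
      have h := hst 0 fun i => by simp
      rwa [show eval (0 : σ → ℂ) p = coeff 0 p by
        rw [MvPolynomial.eval_zero]; exact congr_fun constantCoeff_eq p] at h
    have hκ : coeff κ (invOp κ p) ≠ 0 := by
      have := coeff_invOp hp (Finsupp.le_def.2 fun i => Nat.zero_le (κ i) : (0 : σ →₀ ℕ) ≤ κ)
      rw [tsub_zero] at this
      rwa [this]
    exact le_degVec hκ

/-- **`(ℂ ∖ 𝔻̄)`-stable of degree `κ` ⟹ `I_κ(q)` is `𝔻`-stable.** Off the coordinate hyperplanes this is
`I_κ(q)(z) = z^κ q(1/z)`; at a point of `𝔻ⁿ` with zero coordinates `Z` it is Lemma 1.6: `I_κ(q)(z) =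
(Π_{j∉Z} z_j^{κ_j}) c_Z(q)(1/z) ≠ 0`. [cite: BorceaBranden2009II, §1 Cor. 1.7 (with Lemma 1.6)] -/
theorem invOp_diskStable {q : MvPolynomial σ ℂ} (hst : ∀ z : σ → ℂ, (∀ i, 1 < ‖z i‖) → eval z q ≠ 0)
    (z : σ → ℂ) (hz : ∀ i, ‖z i‖ < 1) : eval z (invOp (degVec q) q) ≠ 0 := by
  rw [eval_invOp_eq_cornerPoly (fun α hα => le_degVec (mem_support_iff.1 hα)) z]
  refine mul_ne_zero (Finset.prod_ne_zero_iff.2 fun j hj => pow_ne_zero _ (Finset.mem_filter.1 hj).2)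
    (eval_cornerPoly_ne_zero hst _ fun j hj => ?_)
  have hzj : z j ≠ 0 := fun h => hj (Finset.mem_filter.2 ⟨Finset.mem_univ j, h⟩)
  rw [norm_inv]
  exact (one_lt_inv₀ (norm_pos_iff.2 hzj)).2 (hz j)

/-- **Borcea–Brändén II, Corollary 1.7** (open disc / exterior of the closed disc). For `κ ∈ ℕⁿ` the
inversion `I_κ(z^α) = z^{κ-α}` is an involution of `ℂ_κ[z]` which maps the `𝔻`-stable polynomials of `ℂ_κ[z]`
to `(ℂ ∖ 𝔻̄)`-stable polynomials of degree `κ`, and the `(ℂ ∖ 𝔻̄)`-stable polynomials of `ℂ_κ[z]` of degree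
`κ` to `𝔻`-stable polynomials. [cite: BorceaBranden2009II, §1 Cor. 1.7] -/
theorem BorceaBranden_diskInversion (κ : σ →₀ ℕ) :
    (∀ p : MvPolynomial σ ℂ, (∀ α ∈ p.support, α ≤ κ) → invOp κ (invOp κ p) = p) ∧
    (∀ p : MvPolynomial σ ℂ, (∀ α ∈ p.support, α ≤ κ) →
      (∀ z : σ → ℂ, (∀ i, ‖z i‖ < 1) → eval z p ≠ 0) →
        (∀ z : σ → ℂ, (∀ i, 1 < ‖z i‖) → eval z (invOp κ p) ≠ 0) ∧ degVec (invOp κ p) = κ) ∧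
    (∀ q : MvPolynomial σ ℂ, degVec q = κ →
      (∀ z : σ → ℂ, (∀ i, 1 < ‖z i‖) → eval z q ≠ 0) →
        ∀ z : σ → ℂ, (∀ i, ‖z i‖ < 1) → eval z (invOp κ q) ≠ 0) :=
  ⟨fun _ hp => invOp_invOp hp,
    fun _ hp hst => ⟨invOp_exteriorDiskStable hp hst, degVec_invOp_eq hp hst⟩,
    fun q hκ hst z hz => by rw [← hκ]; exact invOp_diskStable hst z hz⟩

end Main

end Literature.Combinatorics.StablePolynomials

end
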